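import Summits.NavierStokesRegularity.NavierStokesRegularity.Theorems.Target.Negative.EnergyClassLoadBearing
import Literature.Analysis.FluidPDE.NSQuasipotential
import Literature.Analysis.FluidPDE.LerayLocalRegularH1Proofs

/-!
# Crux `Target` = `TypeICertificateLadder.NoTypeIBlowup` (stmt-NavierStokesRegularity-1217), negative side:
# non-vacuity, and the classical clause is load-bearing (through the representative)

Negative-side (cdisprove, D-0016) lemmas extracted from the crux work file
`Cruxes/Target/Disproof.lean` §8 (gen 3; gen 1 had the second result as evidence only), importable.

* `target_hypotheses_satisfiable` — NON-VACUITY: the rest state `u ≡ 0`, `p ≡ 0` (`ν = T = 1`)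
  meets all four hypotheses of the crux (classical on `[0, 1)`, Leray–Hopf from the rapidly
  decaying datum `0` — tree `isLerayHopfOn_zero` —, Type-I with constant `0`) and extends. With
  `CounterexampleProfile.counterexample_unbounded` the hypotheses are met exactly by bounded
  solutions (which extend) and by genuine Type-I singularities (the open question): no junk.
* `target_false_without_classical` — with the clause `IsClassicalNSSolutionOn (Ico 0 T) ν 0 u p`
  DELETED the statement is FALSE: the spiked rest state (`e₀` on the null line `x = 0` for
  `t > 0`) is Leray–Hopf from rest (`isLerayHopfOn_zero` + `IsLerayHopfOn.congr_ae_slices`),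
  bounded hence Type-I at every `T`, and has NO classical extension because
  `HasSmoothExtensionPast` demands POINTWISE agreement `u' t = u t` on `[0, T)`. Misstated-type
  (the Leray–Hopf class consists of a.e.-defined objects; with `u' t =ᵐ u t` in the conclusion the
  witness passes): the classical clause fixes the continuous representative, and weak / mild-class
  arguments (weak–strong uniqueness, ε-regularity, Kato theory) must be brought back to the
  pointwise `u` — the step `pointwise_bounded_before`. [folklore]

Nothing here closes the item (`--supports`).
-/

noncomputable section

open MeasureTheory TopologicalSpace Set Function Filter Metric
open scoped Topology RealInnerProductSpace ContDiff Laplacian InnerProductSpace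
open Literature.Analysis.FluidPDE

namespace Summit.NavierStokesRegularity.NavierStokesRegularity.Theorems.Target.Negative

/-- Local notation for physical space `ℝ³ = EuclideanSpace ℝ (Fin 3)`. -/
local notation "ℝ³" => EuclideanSpace ℝ (Fin 3)

section Representative

/-- **The hypotheses of the crux are jointly satisfiable (non-vacuity), and then the conclusion
holds**: the rest state `u ≡ 0`, `p ≡ 0` (`ν = T = 1`) is classical on `[0, 1)`, Leray–Hopf from
the rapidly decaying datum `0`, obeys the Type-I rate with constant `0`, and extends (by itself).
Together with §4 (`counterexample_unbounded`): the four hypotheses are met exactly by (i) bounded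
solutions, which extend, and (ii) genuine Type-I singularities, whose existence is the open
question — there is no third, junk, way to satisfy them. -/
theorem target_hypotheses_satisfiable :
    ∃ (ν T : ℝ) (u : ℝ → ℝ³ → ℝ³) (p : ℝ → ℝ³ → ℝ), 0 < ν ∧ 0 < T ∧
      IsClassicalNSSolutionOn (Ico 0 T) ν 0 u p ∧ IsLerayHopfOn T ν 0 (u 0) u ∧
      HasRapidSpatialDecay (u 0) ∧ IsTypeIBlowup u T ∧ HasSmoothExtensionPast ν 0 u T := by
  refine ⟨1, 1, 0, 0, one_pos, one_pos, isClassicalNSSolutionOn_zero _ 1, isLerayHopfOn_zero 1 1,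
    hasRapidSpatialDecay_zero, ⟨0, Eventually.of_forall fun t x => by simp⟩,
    ⟨2, by norm_num, 0, 0, isClassicalNSSolutionOn_zero _ 1, fun t _ => rfl⟩⟩

/-- The spiked rest state: `v(t, x) = e₀` if `0 < t` and `x = 0`, and `0` otherwise — an
a.e.-modification of the rest state on the null line `{x = 0}`, `t > 0`. -/
def spikeVel : ℝ → ℝ³ → ℝ³ := fun t x => if 0 < t ∧ x = 0 then e₀ else 0

/-- The spiked rest state starts from rest. -/
theorem spikeVel_zero : spikeVel 0 = 0 := by
  funext x
  simp [spikeVel]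

/-- Off the line `x = 0` the spiked rest state vanishes. -/
theorem spikeVel_of_ne {t : ℝ} {x : ℝ³} (hx : x ≠ 0) : spikeVel t x = 0 := by
  simp [spikeVel, hx]

/-- On the line `x = 0`, `t > 0`, it equals `e₀`. -/
theorem spikeVel_of_pos {t : ℝ} (ht : 0 < t) : spikeVel t 0 = e₀ := by
  simp [spikeVel, ht]

/-- The spiked rest state is bounded by `1`. -/
theorem norm_spikeVel_le (t : ℝ) (x : ℝ³) : ‖spikeVel t x‖ ≤ 1 := by
  unfold spikeVel
  split_ifs <;> simp

/-- Every slice of the spiked rest state vanishes a.e. -/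
theorem spikeVel_slice_ae_eq (t : ℝ) : spikeVel t =ᵐ[volume] (0 : ℝ³ → ℝ³) := by
  have hsub : {x : ℝ³ | ¬ spikeVel t x = (0 : ℝ³ → ℝ³) x} ⊆ {0} := by
    intro x hx
    by_contra h0
    exact hx (by rw [spikeVel_of_ne h0]; rfl)
  rw [Filter.EventuallyEq, ae_iff]
  exact measure_mono_null hsub (measure_singleton 0)

/-- The spiked rest state vanishes a.e. in space–time. -/
theorem uncurry_spikeVel_ae_eq : uncurry spikeVel =ᵐ[volume] (0 : ℝ × ℝ³ → ℝ³) := by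
  have hsub : {z : ℝ × ℝ³ | ¬ uncurry spikeVel z = (0 : ℝ × ℝ³ → ℝ³) z} ⊆ univ ×ˢ {0} := by
    rintro ⟨t, x⟩ hx
    refine mk_mem_prod (mem_univ _) ?_
    by_contra h0
    exact hx (by simp [uncurry, spikeVel_of_ne h0])
  rw [Filter.EventuallyEq, ae_iff]
  refine measure_mono_null hsub ?_
  rw [Measure.volume_eq_prod, Measure.prod_prod, measure_singleton, mul_zero]

/-- **The spiked rest state is Leray–Hopf from rest** on every `[0, T)`, `T > 0`, for every
viscosity: every clause of `IsLerayHopfOn` sees the slices only through a.e.-stable notions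
(tree: `isLerayHopfOn_zero`, `IsLerayHopfOn.congr_ae_slices`). -/
theorem isLerayHopfOn_spikeVel {T : ℝ} (hT : 0 < T) (ν : ℝ) :
    IsLerayHopfOn T ν 0 (spikeVel 0) spikeVel := by
  rw [spikeVel_zero]
  refine (isLerayHopfOn_zero T ν).congr_ae_slices hT ?_ fun t _ => spikeVel_slice_ae_eq t
  exact (aestronglyMeasurable_const.congr uncurry_spikeVel_ae_eq.symm).restrict

/-- The spiked rest state obeys the Type-I rate at every `T > 0` (it is bounded by `1`, and
`1 ≤ √T / √(T - t)` for `0 ≤ t < T`). -/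
theorem isTypeIBlowup_spikeVel {T : ℝ} (hT : 0 < T) : IsTypeIBlowup spikeVel T := by
  refine ⟨Real.sqrt T, ?_⟩
  filter_upwards [Ioo_mem_nhdsLT hT] with t ht x
  have hpos : 0 < Real.sqrt (T - t) := Real.sqrt_pos.2 (sub_pos.2 ht.2)
  refine (norm_spikeVel_le t x).trans ((one_le_div hpos).2 (Real.sqrt_le_sqrt (by linarith [ht.1])))

/-- **The spiked rest state has no classical extension past any `T > 0`**: an extension would be
a classical field agreeing with `v(T/2, ·)` pointwise, but that slice is discontinuous at `x = 0`. -/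
theorem not_hasSmoothExtensionPast_spikeVel {T : ℝ} (hT : 0 < T) (ν : ℝ) :
    ¬ HasSmoothExtensionPast ν 0 spikeVel T := by
  rintro ⟨T', hT', u', p', hcl, hagree⟩
  have ht₀ : T / 2 ∈ Ico 0 T := ⟨by linarith, by linarith⟩
  have hcont : Continuous (spikeVel (T / 2)) := by
    rw [← hagree (T / 2) ht₀]
    exact (hcl.contDiff_velocity ⟨ht₀.1, ht₀.2.trans hT'⟩).continuous
  -- along `xₙ = (n+1)⁻¹ e₀ → 0` the slice is `0`, at the limit it is `e₀`
  set xs : ℕ → ℝ³ := fun n => (1 / ((n : ℝ) + 1)) • e₀ with hxs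
  have hxs0 : Tendsto xs atTop (𝓝 0) := by
    have h : Tendsto (fun n : ℕ => (1 / ((n : ℝ) + 1)) • e₀) atTop (𝓝 ((0 : ℝ) • e₀)) :=
      (tendsto_one_div_add_atTop_nhds_zero_nat (𝕜 := ℝ)).smul_const e₀
    rwa [zero_smul] at h
  have hne : ∀ n, xs n ≠ 0 := fun n => by
    rw [hxs]
    refine smul_ne_zero (by positivity) ?_
    intro h
    have := norm_e₀
    rw [h, norm_zero] at this
    exact zero_ne_one this
  have hlim : Tendsto (fun n => spikeVel (T / 2) (xs n)) atTop (𝓝 (spikeVel (T / 2) 0)) :=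
    (hcont.tendsto 0).comp hxs0
  have hzero : (fun n => spikeVel (T / 2) (xs n)) = fun _ => 0 := by
    funext n
    exact spikeVel_of_ne (hne n)
  rw [hzero, spikeVel_of_pos (by linarith : 0 < T / 2)] at hlim
  have he : e₀ = 0 := (tendsto_nhds_unique tendsto_const_nhds hlim).symm
  have := norm_e₀
  rw [he, norm_zero] at this
  exact zero_ne_one this

/-- The crux with the classical clause `IsClassicalNSSolutionOn (Ico 0 T) ν 0 u p` DELETED (so the
pressure disappears too): a Leray–Hopf solution from a rapidly decaying datum with the Type-I
rate extends classically. -/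
def TargetWithoutClassical : Prop :=
  ∀ (ν T : ℝ), 0 < ν → 0 < T → ∀ (u : ℝ → ℝ³ → ℝ³),
    IsLerayHopfOn T ν 0 (u 0) u → HasRapidSpatialDecay (u 0) → IsTypeIBlowup u T →
    HasSmoothExtensionPast ν 0 u T

/-- **The classical clause is load-bearing — through the representative.** With
`IsClassicalNSSolutionOn` deleted the statement is FALSE, witnessed by the spiked rest state: it
is Leray–Hopf from the datum `0`, bounded (so Type-I at every `T`), and has no classical extension
since the conclusion `HasSmoothExtensionPast` asks for POINTWISE agreement `u' t = u t` on
`[0, T)`. Classification if it were the crux: refuted-misstated (the Leray–Hopf class consists of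
a.e.-defined objects; repaired statement: conclude `∃` a classical `u'` with `u' t =ᵐ u t`, which
for this witness holds). For provers: any argument run in the weak / mild class (weak–strong
uniqueness, ε-regularity, Kato theory) produces a.e. or `L^∞` information and must be brought
back to the pointwise `u` through the joint continuity supplied by the classical clause — exactly
the step `pointwise_bounded_before` of §4. -/
theorem target_false_without_classical : ¬ TargetWithoutClassical := fun h =>
  not_hasSmoothExtensionPast_spikeVel one_pos 1
    (h 1 1 one_pos one_pos spikeVel (isLerayHopfOn_spikeVel one_pos 1)
      (by rw [spikeVel_zero]; exact hasRapidSpatialDecay_zero) (isTypeIBlowup_spikeVel one_pos))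

end Representative

end Summit.NavierStokesRegularity.NavierStokesRegularity.Theorems.Target.Negative

end
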